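import Summits.AtomisticToContinuum.HydrodynamicLimit.Theses.JParityClosure

/-!
# The thermodynamic contact value of `EvenStressEnskog` is `0` at zero density

Negative knowledge for the crux `JParityClosure.EvenStressEnskog` (stmt-AtomisticToContinuum-13079), from the
standing disprover's `Cruxes/EvenStressEnskog/Disproof.lean` §3/§5. The crux compares the collisional
momentum-transfer statistics with the Enskog functional built on `Y a = (3/2π) · deriv hsExcessFreeEnergy a`.
Because `Real.rpow` of a negative base satisfies `x^{1/3} = |x|^{1/3} cos(π/3) = (−x/8)^{1/3}`, the tree's
`hsFreeVolume η N` (diameter `(η/N)^{1/3}`) is the SAME at `η < 0` and at `−η/8 > 0`; hence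
`hsExcessFreeEnergy η = hsExcessFreeEnergy (−η/8)` for `η ≤ 0`, and a two-sided derivative `D` at `0`, if it
exists, satisfies `D = −D/8`. So `deriv hsExcessFreeEnergy 0 = 0` UNCONDITIONALLY (junk `0` otherwise), i.e. the
crux's contact value is `Y 0 = 0` where physics has `Y(0⁺) = 1` (second virial coefficient `f_ex′(0⁺) = 2π/3`,
HsEosLowDensity stmt-0768 — which correctly states it for an analytic `F` agreeing with `f_ex` on `Ico 0 η₀` only).
In the crux this junk is harmless (it is multiplied by the pair functional `B_r`, which vanishes wherever the
mollified density does — `Negative/PairFunctionalVanishing.lean`), but two natural auxiliary statements a prover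
might write are FALSE: a contact-value floor `1 ≤ Y` on the CLOSED band `Ico 0 η₀`, and right-continuity of `Y`
at `0` given the physical limit `Y(0⁺) = 1`. State every property of `Y` on `Ioo 0 η₀` / through `F`.
refuter-cdisprove-stmt-AtomisticToContinuum-13079-0.
-/

noncomputable section

namespace Summit.AtomisticToContinuum.HydrodynamicLimit.Theorems

open Filter Set Topology
open Literature.MathematicalPhysics.KineticTheory

namespace EvenStressEnskog

/-- `Real.rpow` of a negative base at exponent `1/3`: `x^{1/3} = (−x/8)^{1/3}` for `x < 0`. [folklore] -/
theorem rpow_third_of_neg {x : ℝ} (hx : x < 0) :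
    x ^ (1 / 3 : ℝ) = (-x / 8) ^ (1 / 3 : ℝ) := by
  have hx' : 0 < -x / 8 := by linarith
  rw [Real.rpow_def_of_neg hx, Real.rpow_def_of_pos hx']
  have h8 : Real.log 8 = 3 * Real.log 2 := by
    rw [show (8 : ℝ) = 2 ^ 3 by norm_num, Real.log_pow]; norm_num
  have hlog : Real.log (-x / 8) = Real.log (-x) - Real.log 8 :=
    Real.log_div (by linarith) (by norm_num)
  rw [hlog, h8, Real.log_neg_eq_log, show (1 / 3 : ℝ) * Real.pi = Real.pi / 3 by ring,
    Real.cos_pi_div_three, sub_mul, Real.exp_sub]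
  rw [show 3 * Real.log 2 * (1 / 3 : ℝ) = Real.log 2 by ring, Real.exp_log two_pos]
  ring

/-- The free volume at a negative reduced density `η` equals the free volume at `−η/8`. [folklore] -/
theorem hsFreeVolume_of_neg {η : ℝ} (hη : η < 0) (N : ℕ) :
    hsFreeVolume η N = hsFreeVolume (-η / 8) N := by
  unfold hsFreeVolume
  rcases Nat.eq_zero_or_pos N with hN | hN
  · subst hN; simp
  · have hNr : (0 : ℝ) < N := by exact_mod_cast hN
    have h1 : η / N < 0 := div_neg_of_neg_of_pos hη hNr
    rw [rpow_third_of_neg h1, show -(η / (N : ℝ)) / 8 = (-η / 8) / N by ring]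

/-- `hsExcessFreeEnergy η = hsExcessFreeEnergy (−η/8)` for `η ≤ 0`. [folklore] -/
theorem hsExcessFreeEnergy_of_nonpos {η : ℝ} (hη : η ≤ 0) :
    hsExcessFreeEnergy η = hsExcessFreeEnergy (-η / 8) := by
  rcases hη.lt_or_eq with h | h
  · unfold hsExcessFreeEnergy
    simp_rw [hsFreeVolume_of_neg h]
  · subst h; simp

/-- **`deriv hsExcessFreeEnergy 0 = 0`** unconditionally (the physical right derivative is `2π/3`). [folklore] -/
theorem deriv_hsExcessFreeEnergy_zero : deriv hsExcessFreeEnergy 0 = 0 := by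
  by_cases hd : DifferentiableAt ℝ hsExcessFreeEnergy 0
  · set D := deriv hsExcessFreeEnergy 0 with hD
    have h1 : HasDerivAt hsExcessFreeEnergy D 0 := hd.hasDerivAt
    have hφ : HasDerivAt (fun η : ℝ => -η / 8) (-1 / 8) 0 := by
      simpa using ((hasDerivAt_id (0 : ℝ)).neg.div_const 8)
    have h2 : HasDerivAt (hsExcessFreeEnergy ∘ fun η : ℝ => -η / 8) (D * (-1 / 8)) 0 := by
      have h1' : HasDerivAt hsExcessFreeEnergy D ((fun η : ℝ => -η / 8) 0) := by
        rw [show (fun η : ℝ => -η / 8) 0 = (0 : ℝ) by norm_num]; exact h1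
      exact h1'.comp (0 : ℝ) hφ
    have hU : UniqueDiffWithinAt ℝ (Set.Iic (0 : ℝ)) 0 := uniqueDiffOn_Iic 0 0 Set.self_mem_Iic
    have h3 : HasDerivWithinAt hsExcessFreeEnergy (D * (-1 / 8)) (Set.Iic 0) 0 :=
      h2.hasDerivWithinAt.congr (fun y hy => by
        simpa using hsExcessFreeEnergy_of_nonpos (Set.mem_Iic.mp hy)) (by simp)
    have h4 : HasDerivWithinAt hsExcessFreeEnergy D (Set.Iic 0) 0 := h1.hasDerivWithinAt
    have h5 : D = D * (-1 / 8) := (h4.derivWithin hU).symm.trans (h3.derivWithin hU)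
    linarith
  · exact deriv_zero_of_not_differentiableAt hd

/-- The crux's contact value `Y a = 3/(2π) · deriv hsExcessFreeEnergy a` is `0` at `a = 0`. [folklore] -/
theorem contactValue_zero : 3 / (2 * Real.pi) * deriv hsExcessFreeEnergy 0 = 0 := by
  simp [deriv_hsExcessFreeEnergy_zero]

/-- **False auxiliary claim:** a floor `1 ≤ Y a` on the closed band `Ico 0 η₀` (the "Enskog contact value
`≥ 1`" of the RateFloor docstring, stated with the left end closed). [folklore] -/
theorem not_one_le_contactValue_on_Ico {η₀ : ℝ} (hη₀ : 0 < η₀) :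
    ¬ ∀ a ∈ Set.Ico 0 η₀, 1 ≤ 3 / (2 * Real.pi) * deriv hsExcessFreeEnergy a := by
  intro h
  have := h 0 ⟨le_rfl, hη₀⟩
  rw [contactValue_zero] at this
  linarith

/-- **False auxiliary claim:** given the physical limit `Y(0⁺) = 1` (HsEosLowDensity + virial theorem), the crux's
`Y` is NOT right-continuous at `0`. [folklore] -/
theorem not_continuousWithinAt_contactValue
    (hlim : Tendsto (fun a => 3 / (2 * Real.pi) * deriv hsExcessFreeEnergy a) (𝓝[>] 0) (𝓝 1)) :
    ¬ ContinuousWithinAt (fun a => 3 / (2 * Real.pi) * deriv hsExcessFreeEnergy a) (Set.Ici 0) 0 := by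
  intro hc
  have h1 : Tendsto (fun a => 3 / (2 * Real.pi) * deriv hsExcessFreeEnergy a) (𝓝[>] 0)
      (𝓝 (3 / (2 * Real.pi) * deriv hsExcessFreeEnergy 0)) :=
    hc.tendsto.mono_left (nhdsWithin_mono _ Set.Ioi_subset_Ici_self)
  rw [contactValue_zero] at h1
  have := tendsto_nhds_unique h1 hlim
  norm_num at this

/-- For contrast: `hsCompressibility 0 = 1` does hold, because there the junk derivative is multiplied by
`η = 0`. [folklore] -/
theorem hsCompressibility_zero : hsCompressibility 0 = 1 := by simp [hsCompressibility]

end EvenStressEnskog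

end Summit.AtomisticToContinuum.HydrodynamicLimit.Theorems

end
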